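import Summits.BirchSwinnertonDyer.BirchSwinnertonDyer.Theses.ShaPrimaryTransfer
import Summits.BirchSwinnertonDyer.BirchSwinnertonDyer.Theses.TwoAdicConverse
import Summits.BirchSwinnertonDyer.BirchSwinnertonDyer.Theorems.SelmerRankShaCorank
import Literature.NumberTheory.EllipticCurves.BSDSelmerPConverseRankZeroOrdinaryProofs
import Literature.NumberTheory.EllipticCurves.SupersingularDensityProofs
import Literature.NumberTheory.EllipticCurves.OpenImage
import Literature.NumberTheory.EllipticCurves.BSDSelmer
import Literature.NumberTheory.EllipticCurves.IwasawaLeadingTermProofs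
import Literature.NumberTheory.EllipticCurves.LeadingTerm

/-!
# BirchSwinnertonDyer / ShaPrimaryTransfer — crux `FiniteShaComponentTransfer` (stmt-BirchSwinnertonDyer-22356):
# the non-CM rank ≤ 1 door at 2 versus the registered 2-CONVERSE items of route `TwoAdicConverse`

Fifth helper file of prover seat `bsd-line-spt-p1` (`--supports stmt-22356 --as helper`). The companion
`…DoorAtTwo` (g0) showed: the registered leaf `Rank1Residual.NonCMTwoConverse` + GZK IMPLY the transfer out of the
door prime `2` for non-CM curves of rank ≤ 1 (ordinary or multiplicative at `2`). This file proves the OPPOSITE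
domination, item by item, for the route's load-bearing WEAK transfer («`t_{p₀}(E) = 0` at any prime ⟹ `t_q(E) = 0`
at every good ordinary `q ≥ 5`, on global minimal models» — the hypothesis of
`ShaPrimaryTransferWeakTransfer.bsd_of_weakTransfer`), granting printed theorems at the TARGET prime only:

* §1 SUPPLY (Serre/Deuring + Mazur). Every `E/ℚ` has a good ordinary prime `q > 163` (tree THEOREM
  `infinite_goodOrdinaryPrimes_holds`), where `E[q]` is irreducible by Mazur 1978 Thm. 1 (named fact
  `mazur_isogeny_irreducible`): `exists_goodOrdinary_irreducible`.
* §2 RANK 0. Weak transfer ⟹ «non-CM `E`, `corank Sel_{2^∞}(E/ℚ) = 0 ⟹ L(E,1) ≠ 0`» for EVERY reduction type at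
  `2` — additive included (`rankZeroTwoConverse_of_weakTransfer`), granting modularity (`hmod`), the cyclotomic
  main conjecture at good ordinary irreducible `q ≥ 5` (Burungale–Castella–Skinner 2025 Thm. 1.1.2, `hMC`, through
  the tree theorem `analyticRank_eq_zero_of_selmerCorank_eq_zero_of_mazurMainConjecture`) and Mazur (`hM`). By name
  it concludes the registered items `TwoAdicConverse.GoodOrdinaryRankZeroTwoConverse` (stmt-19218) and
  `TwoAdicConverse.MultiplicativeRankZeroTwoConverse` (stmt-19219), both XL/open
  (`goodOrdinaryRankZeroTwoConverse_of_weakTransfer`, `multiplicativeRankZeroTwoConverse_of_weakTransfer`).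
* §3 RANK 1. Weak transfer ⟹ the Ш-finite («Kim») shape of the rank-one 2-converse for non-CM curves — «`rank
  E(ℚ) = 1 ∧ t_2(E) = 0 ⟹ ord_{s=1} L(E,s) = 1`», any reduction at `2` — granting Kim 2022 Cor. 1.4 at the target
  prime (`hKim`) and Mazur (`rankOneTwoConverseKimShape_of_weakTransfer`); the registered item
  `TwoAdicConverse.RankOneTwoConverse` (stmt-19220, Selmer shape «`corank Sel_{2^∞} = 1 ⟹ ord = 1`») follows once
  «`corank Sel_{2^∞} = 1 ⟹ rank ≥ 1`» (Ш[2^∞]-freeness in corank one, the shape of `CongruentShaFreeCut` crux A)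
  is added (`rankOneTwoConverse_of_weakTransfer_of_rankPos`).
* §4 THE SECTOR IS THE ITEMS. Conversely the items + GZK give the weak transfer back on their sectors, so on
  {non-CM, good ordinary at 2, rank 0} the slice of the weak transfer ⟺ stmt-19218 and on {non-CM, multiplicative
  at 2, rank 0} ⟺ stmt-19219, modulo (`hmod`, `hMC`, `hM`; `hGZK`)
  (`goodOrdinaryRankZeroTwoConverse_iff_slice`, `multiplicativeRankZeroTwoConverse_iff_slice`).

Numbers, not adjectives: with `…RepairCensus` §3 (CM rank 1 at the additive prime 2 = `CongruentShaFreeCut` crux B)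
this places THREE registered XL items inside the weak transfer at algebraic rank ≤ 1. Every theorem is proved over
the tree with the printed inputs as explicit named-fact hypotheses; nothing here proves T, the items, or BSD.

References: B. Mazur, Invent. Math. 44 (1978), Thm. 1; J.-P. Serre, Publ. Math. IHÉS 54 (1981), §8; A. Burungale,
F. Castella, C. Skinner, IMRN (2025), Thm. 1.1.2; C.-H. Kim, Math. Ann. 387 (2022), Cor. 1.4; R. Greenberg, LNM 1716
(1999), §1 and Thm. 4.1; V. Kolyvagin (1990), Thm. A / Gross–Zagier (1986) via H. Darmon, CBMS 101 (2004), Thm. 3.22.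
-/

-- D-0017: single-problem summit, so `Summit.BirchSwinnertonDyer.BirchSwinnertonDyer.…` repeats a namespace BY DESIGN.
set_option linter.dupNamespace false

noncomputable section

namespace Summit.BirchSwinnertonDyer.BirchSwinnertonDyer.Theorems.ShaPrimaryTransferTwoConverseItems

open scoped Classical
open Literature.NumberTheory.EllipticCurves Literature.NumberTheory.EllipticCurves.Rank1Residual
open Literature.NumberTheory.EllipticCurves.ModularForms (exists_isNewformOf)
open WeierstrassCurve
open Summit.BirchSwinnertonDyer.BirchSwinnertonDyer.Theses.ShaPrimaryTransfer (FiniteShaComponentTransfer)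
open Summit.BirchSwinnertonDyer.BirchSwinnertonDyer.Theses.TwoAdicConverse
  (GoodOrdinaryRankZeroTwoConverse MultiplicativeRankZeroTwoConverse RankOneTwoConverse)

/-! ## §1 Supply: a good ordinary prime beyond Mazur's list -/

/-- **Every `E/ℚ` (global minimal model) has a good ordinary prime `q > 163`** — so `q ≥ 5` and `q` is outside
Mazur's list `{2, …, 163}` — by the tree THEOREM `infinite_goodOrdinaryPrimes_holds` (infinitely many good
ordinary primes; Serre 1981 §8 / Deuring 1941, proved in the tree by an elementary splitting argument).
[cite: Serre1981, §8 Cor. 2] -/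
theorem exists_goodOrdinary_gt (W : WeierstrassCurve ℚ) [W.IsElliptic] [W.IsGloballyMinimal] :
    ∃ (q : ℕ) (_ : Fact q.Prime), 163 < q ∧ W.HasGoodReductionAtPrime q ∧ ¬ (q : ℤ) ∣ W.frobeniusTrace q := by
  obtain ⟨q, ⟨hq, hgood, hord⟩, hgt⟩ := (infinite_goodOrdinaryPrimes_holds W).exists_gt 163
  exact ⟨q, hq, hgt, hgood, hord⟩

/-- **Supply for the `p`-converses at the target prime**: granting Mazur 1978 Thm. 1 (`hM`, named fact
`mazur_isogeny_irreducible`: `E[q]` irreducible for `q ∉ {2, …, 163}`), every `E/ℚ` (global minimal model) has a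
prime `q ≥ 5` of good ORDINARY reduction with `E[q]` IRREDUCIBLE. CONDITIONAL on `hM`.
[cite: Mazur1978, Thm 1] [cite: Serre1981, §8 Cor. 2] -/
theorem exists_goodOrdinary_irreducible (hM : mazur_isogeny_irreducible) (W : WeierstrassCurve ℚ)
    [W.IsElliptic] [W.IsGloballyMinimal] :
    ∃ (q : ℕ) (_ : Fact q.Prime), 5 ≤ q ∧ W.HasGoodReductionAtPrime q ∧ ¬ (q : ℤ) ∣ W.frobeniusTrace q ∧
      W.HasIrreducibleModPGaloisRep q := by
  obtain ⟨q, hq, hgt, hgood, hord⟩ := exists_goodOrdinary_gt W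
  exact ⟨q, hq, by omega, hgood, hord, hM W q hq.out (not_mem_mazurPrimes_of_lt hgt)⟩

/-! ## §2 Rank 0: the weak transfer contains the rank-zero 2-converse items (stmt-19218, stmt-19219) -/

/-- **Weak transfer ⟹ the rank-zero 2-converse for non-CM curves, ANY reduction type at `2`.** Granting
modularity (`hmod`), the cyclotomic main conjecture at good ordinary irreducible primes `≥ 5` (`hMC`,
Burungale–Castella–Skinner 2025 Thm. 1.1.2) and Mazur (`hM`): if the door datum at ANY prime transfers to every
good ordinary `q ≥ 5` (`hTw`), then `corank_{ℤ_2} Sel_{2^∞}(E/ℚ) = 0 ⟹ ord_{s=1} L(E,s) = 0` for EVERY `E/ℚ`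
(CM or not). Proof: `s_2 = 0` gives `rank = 0`, `t_2 = 0` (Greenberg's identity); `hTw` moves `t = 0` to the supplied
good ordinary irreducible `q`; there `s_q = rank + t_q = 0` and the rank-zero `q`-converse
(`analyticRank_eq_zero_of_selmerCorank_eq_zero_of_mazurMainConjecture`) gives `L(E,1) ≠ 0`. The items'
non-CM and reduction-type hypotheses are idle. CONDITIONAL on `hmod`, `hMC`, `hM`, `hTw`.
[cite: BurungaleCastellaSkinner2025, Thm. 1.1.2 (a)] [cite: Mazur1978, Thm 1] -/
theorem rankZeroTwoConverse_of_weakTransfer (hmod : exists_isNewformOf)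
    (hMC : burungale_castella_skinner_charIdeal_eq_padicLFunction) (hM : mazur_isogeny_irreducible)
    (hTw : ∀ (W : WeierstrassCurve ℚ) [W.IsElliptic] [W.IsGloballyMinimal] (p₀ q : ℕ) [Fact p₀.Prime]
      [Fact q.Prime], 5 ≤ q → W.HasGoodReductionAtPrime q → ¬ (q : ℤ) ∣ W.frobeniusTrace q →
      W.shaCorank p₀ = 0 → W.shaCorank q = 0)
    (W : WeierstrassCurve ℚ) [W.IsElliptic] [W.IsGloballyMinimal] (hs : W.selmerCorank 2 = 0) :
    W.analyticRank = 0 := by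
  obtain ⟨q, hq, hq5, hgood, hord, hirr⟩ := exists_goodOrdinary_irreducible hM W
  have e2 := W.selmerCorank_eq_mordellWeilRank_add_holds 2
  have eq := W.selmerCorank_eq_mordellWeilRank_add_holds q
  have ht : W.shaCorank q = 0 := hTw W 2 q hq5 hgood hord (by omega)
  exact analyticRank_eq_zero_of_selmerCorank_eq_zero_of_mazurMainConjecture hmod hMC W q hq5 hgood hord hirr
    (by omega)

/-- **Weak transfer ⟹ `TwoAdicConverse.GoodOrdinaryRankZeroTwoConverse` (stmt-BirchSwinnertonDyer-19218)**, the
registered rank-zero 2-converse for non-CM curves good ordinary at `2` (XL, open), granting `hmod`, `hMC`, `hM`.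
CONDITIONAL; credits nothing to the item. [cite: BurungaleCastellaSkinner2025, Thm. 1.1.2 (a)] [cite: Mazur1978, Thm 1] -/
theorem goodOrdinaryRankZeroTwoConverse_of_weakTransfer (hmod : exists_isNewformOf)
    (hMC : burungale_castella_skinner_charIdeal_eq_padicLFunction) (hM : mazur_isogeny_irreducible)
    (hTw : ∀ (W : WeierstrassCurve ℚ) [W.IsElliptic] [W.IsGloballyMinimal] (p₀ q : ℕ) [Fact p₀.Prime]
      [Fact q.Prime], 5 ≤ q → W.HasGoodReductionAtPrime q → ¬ (q : ℤ) ∣ W.frobeniusTrace q →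
      W.shaCorank p₀ = 0 → W.shaCorank q = 0) :
    GoodOrdinaryRankZeroTwoConverse :=
  fun W _ _ _ _ hs => rankZeroTwoConverse_of_weakTransfer hmod hMC hM hTw W hs

/-- **Weak transfer ⟹ `TwoAdicConverse.MultiplicativeRankZeroTwoConverse` (stmt-BirchSwinnertonDyer-19219)**, the
registered rank-zero 2-converse for non-CM curves multiplicative at `2` (XL, open), granting `hmod`, `hMC`, `hM`.
CONDITIONAL; credits nothing to the item. [cite: BurungaleCastellaSkinner2025, Thm. 1.1.2 (a)] [cite: Mazur1978, Thm 1] -/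
theorem multiplicativeRankZeroTwoConverse_of_weakTransfer (hmod : exists_isNewformOf)
    (hMC : burungale_castella_skinner_charIdeal_eq_padicLFunction) (hM : mazur_isogeny_irreducible)
    (hTw : ∀ (W : WeierstrassCurve ℚ) [W.IsElliptic] [W.IsGloballyMinimal] (p₀ q : ℕ) [Fact p₀.Prime]
      [Fact q.Prime], 5 ≤ q → W.HasGoodReductionAtPrime q → ¬ (q : ℤ) ∣ W.frobeniusTrace q →
      W.shaCorank p₀ = 0 → W.shaCorank q = 0) :
    MultiplicativeRankZeroTwoConverse :=
  fun W _ _ _ _ hs => rankZeroTwoConverse_of_weakTransfer hmod hMC hM hTw W hs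

/-- **T ⟹ both rank-zero 2-converse items** (T ⟹ weak transfer), granting `hmod`, `hMC`, `hM`. CONDITIONAL.
[cite: BurungaleCastellaSkinner2025, Thm. 1.1.2 (a)] [cite: Mazur1978, Thm 1] -/
theorem rankZeroTwoConverses_of_finiteShaComponentTransfer (hmod : exists_isNewformOf)
    (hMC : burungale_castella_skinner_charIdeal_eq_padicLFunction) (hM : mazur_isogeny_irreducible)
    (hT : FiniteShaComponentTransfer) :
    GoodOrdinaryRankZeroTwoConverse ∧ MultiplicativeRankZeroTwoConverse :=
  have hTw : ∀ (W : WeierstrassCurve ℚ) [W.IsElliptic] [W.IsGloballyMinimal] (p₀ q : ℕ) [Fact p₀.Prime]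
      [Fact q.Prime], 5 ≤ q → W.HasGoodReductionAtPrime q → ¬ (q : ℤ) ∣ W.frobeniusTrace q →
      W.shaCorank p₀ = 0 → W.shaCorank q = 0 := fun W _ _ p₀ q _ _ _ _ _ h0 => hT W p₀ q h0
  ⟨goodOrdinaryRankZeroTwoConverse_of_weakTransfer hmod hMC hM hTw,
    multiplicativeRankZeroTwoConverse_of_weakTransfer hmod hMC hM hTw⟩

/-! ## §3 Rank 1: the weak transfer gives the Ш-finite (Kim) shape of the rank-one 2-converse -/

/-- **Weak transfer ⟹ Kim's Corollary 1.4 AT `p = 2`** (the case his paper excludes, `p > 3`): granting Kim 2022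
Cor. 1.4 at good ordinary irreducible `q > 3` (`hKim`) and Mazur (`hM`), for every NON-CM `E/ℚ` (global minimal
model, any reduction at `2`): `rank E(ℚ) = 1 ∧ t_2(E) = 0 ⟹ ord_{s=1} L(E,s) = 1`. Proof: `hTw` moves `t_2 = 0` to
the supplied `q`, where `Ш(E)[q^∞]` is then finite (`finite_primaryComponent_sha_iff_shaCorank_eq_zero`) and Kim's
converse applies. CONDITIONAL on `hKim`, `hM`, `hTw`. [cite: Kim2022, Cor. 1.4] [cite: Mazur1978, Thm 1] -/
theorem rankOneTwoConverseKimShape_of_weakTransfer (hKim : kim_analyticRank_eq_one_of_mordellWeilRank_eq_one)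
    (hM : mazur_isogeny_irreducible)
    (hTw : ∀ (W : WeierstrassCurve ℚ) [W.IsElliptic] [W.IsGloballyMinimal] (p₀ q : ℕ) [Fact p₀.Prime]
      [Fact q.Prime], 5 ≤ q → W.HasGoodReductionAtPrime q → ¬ (q : ℤ) ∣ W.frobeniusTrace q →
      W.shaCorank p₀ = 0 → W.shaCorank q = 0)
    (W : WeierstrassCurve ℚ) [W.IsElliptic] [W.IsGloballyMinimal] (hncm : ¬ W.HasCM)
    (hr : W.mordellWeilRank = 1) (h0 : W.shaCorank 2 = 0) : W.analyticRank = 1 := by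
  obtain ⟨q, hq, hq5, hgood, hord, hirr⟩ := exists_goodOrdinary_irreducible hM W
  have ht : W.shaCorank q = 0 := hTw W 2 q hq5 hgood hord h0
  exact (hKim W hncm q (by omega) hgood hord hirr hr
    ((finite_primaryComponent_sha_iff_shaCorank_eq_zero W q).2 ht)).1

/-- **The registered item `TwoAdicConverse.RankOneTwoConverse` (stmt-BirchSwinnertonDyer-19220) from the weak
transfer plus Ш[2^∞]-freeness in corank one.** Its Selmer shape «`corank Sel_{2^∞} = 1 ⟹ ord = 1`» is the Kim
shape of §3 plus «`corank Sel_{2^∞} = 1 ⟹ rank ≥ 1`» (`hA`, the shape of `CongruentShaFreeCut` crux A; under it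
`corank 1` forces `rank = 1`, `t_2 = 0`). CONDITIONAL on `hKim`, `hM`, `hTw`, `hA`; credits nothing to the item.
[cite: Kim2022, Cor. 1.4] [cite: Mazur1978, Thm 1] -/
theorem rankOneTwoConverse_of_weakTransfer_of_rankPos
    (hKim : kim_analyticRank_eq_one_of_mordellWeilRank_eq_one) (hM : mazur_isogeny_irreducible)
    (hTw : ∀ (W : WeierstrassCurve ℚ) [W.IsElliptic] [W.IsGloballyMinimal] (p₀ q : ℕ) [Fact p₀.Prime]
      [Fact q.Prime], 5 ≤ q → W.HasGoodReductionAtPrime q → ¬ (q : ℤ) ∣ W.frobeniusTrace q →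
      W.shaCorank p₀ = 0 → W.shaCorank q = 0)
    (hA : ∀ (W : WeierstrassCurve ℚ) [W.IsElliptic] [W.IsGloballyMinimal], ¬ W.HasCM →
      (GoodOrd W 2 ∨ Mult W 2) → W.selmerCorank 2 = 1 → 1 ≤ W.mordellWeilRank) :
    RankOneTwoConverse := by
  intro W _ _ hncm hred hs
  have h1 := hA W hncm hred hs
  have e2 := W.selmerCorank_eq_mordellWeilRank_add_holds 2
  exact rankOneTwoConverseKimShape_of_weakTransfer hKim hM hTw W hncm (by omega) (by omega)

/-! ## §4 The sector is the items: equivalences on {non-CM, rank 0, door 2} -/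

/-- **Item 19218 gives the slice back (granting GZK).** `GoodOrdinaryRankZeroTwoConverse` + Gross–Zagier–Kolyvagin
(`hGZK`): for non-CM `E` good ordinary at `2` with `rank E(ℚ) = 0`, `t_2(E) = 0 ⟹ t_q(E) = 0` at EVERY prime `q`
(`s_2 = rank + t_2 = 0`, the item gives `L(E,1) ≠ 0`, GZK makes `Ш(E)` finite). CONDITIONAL on `hC`, `hGZK`.
[cite: Darmon2004, Thm. 3.22 (= Thm. 1.14) and §3.9] -/
theorem slice_of_goodOrdinaryRankZeroTwoConverse (hC : GoodOrdinaryRankZeroTwoConverse)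
    (hGZK : rank_eq_analyticRank_of_analyticRank_le_one) (W : WeierstrassCurve ℚ) [W.IsElliptic]
    [W.IsGloballyMinimal] (hncm : ¬ W.HasCM) (hred : GoodOrd W 2) (hr : W.mordellWeilRank = 0)
    (h0 : W.shaCorank 2 = 0) (q : ℕ) [Fact q.Prime] : W.shaCorank q = 0 := by
  have e2 := W.selmerCorank_eq_mordellWeilRank_add_holds 2
  have ha : W.analyticRank = 0 := hC W hncm hred (by omega)
  haveI : Finite ↥W.sha := (hGZK W (by omega)).2
  exact Literature.BSD.shaCorank_eq_zero_of_finite W q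
    (inferInstance : Finite ↥(AddCommGroup.primaryComponent W.sha q))

/-- **Item 19219 gives the slice back (granting GZK)**: the same for non-CM `E` MULTIPLICATIVE at `2` with
`rank E(ℚ) = 0`. CONDITIONAL on `hC`, `hGZK`. [cite: Darmon2004, Thm. 3.22 (= Thm. 1.14) and §3.9] -/
theorem slice_of_multiplicativeRankZeroTwoConverse (hC : MultiplicativeRankZeroTwoConverse)
    (hGZK : rank_eq_analyticRank_of_analyticRank_le_one) (W : WeierstrassCurve ℚ) [W.IsElliptic]
    [W.IsGloballyMinimal] (hncm : ¬ W.HasCM) (hred : Mult W 2) (hr : W.mordellWeilRank = 0)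
    (h0 : W.shaCorank 2 = 0) (q : ℕ) [Fact q.Prime] : W.shaCorank q = 0 := by
  have e2 := W.selmerCorank_eq_mordellWeilRank_add_holds 2
  have ha : W.analyticRank = 0 := hC W hncm hred (by omega)
  haveI : Finite ↥W.sha := (hGZK W (by omega)).2
  exact Literature.BSD.shaCorank_eq_zero_of_finite W q
    (inferInstance : Finite ↥(AddCommGroup.primaryComponent W.sha q))

/-- **stmt-19218 ⟺ the slice of the weak transfer on {non-CM, good ordinary at 2, rank 0}**, granting `hmod`,
`hMC`, `hM` (⟸) and `hGZK` (⟹): «non-CM, good ordinary at `2`: `corank Sel_{2^∞} = 0 ⟹ L(E,1) ≠ 0`» is the same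
statement as «non-CM, good ordinary at `2`, `rank E(ℚ) = 0`: `t_2(E) = 0 ⟹ t_q(E) = 0` at every good ordinary
`q ≥ 5`». CONDITIONAL. [cite: BurungaleCastellaSkinner2025, Thm. 1.1.2 (a)] [cite: Mazur1978, Thm 1]
[cite: Darmon2004, Thm. 3.22 (= Thm. 1.14) and §3.9] -/
theorem goodOrdinaryRankZeroTwoConverse_iff_slice (hmod : exists_isNewformOf)
    (hMC : burungale_castella_skinner_charIdeal_eq_padicLFunction) (hM : mazur_isogeny_irreducible)
    (hGZK : rank_eq_analyticRank_of_analyticRank_le_one) :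
    GoodOrdinaryRankZeroTwoConverse ↔
      ∀ (W : WeierstrassCurve ℚ) [W.IsElliptic] [W.IsGloballyMinimal], ¬ W.HasCM → GoodOrd W 2 →
        W.mordellWeilRank = 0 → W.shaCorank 2 = 0 → ∀ (q : ℕ) [Fact q.Prime], 5 ≤ q →
          W.HasGoodReductionAtPrime q → ¬ (q : ℤ) ∣ W.frobeniusTrace q → W.shaCorank q = 0 := by
  constructor
  · intro hC W _ _ hncm hred hr h0 q _ _ _ _
    exact slice_of_goodOrdinaryRankZeroTwoConverse hC hGZK W hncm hred hr h0 q
  · intro hsl W _ _ hncm hred hs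
    obtain ⟨q, hq, hq5, hgood, hord, hirr⟩ := exists_goodOrdinary_irreducible hM W
    have e2 := W.selmerCorank_eq_mordellWeilRank_add_holds 2
    have eq := W.selmerCorank_eq_mordellWeilRank_add_holds q
    have ht : W.shaCorank q = 0 := hsl W hncm hred (by omega) (by omega) q hq5 hgood hord
    exact analyticRank_eq_zero_of_selmerCorank_eq_zero_of_mazurMainConjecture hmod hMC W q hq5 hgood hord hirr
      (by omega)

/-- **stmt-19219 ⟺ the slice of the weak transfer on {non-CM, multiplicative at 2, rank 0}**, granting `hmod`,
`hMC`, `hM` (⟸) and `hGZK` (⟹). CONDITIONAL. [cite: BurungaleCastellaSkinner2025, Thm. 1.1.2 (a)]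
[cite: Mazur1978, Thm 1] [cite: Darmon2004, Thm. 3.22 (= Thm. 1.14) and §3.9] -/
theorem multiplicativeRankZeroTwoConverse_iff_slice (hmod : exists_isNewformOf)
    (hMC : burungale_castella_skinner_charIdeal_eq_padicLFunction) (hM : mazur_isogeny_irreducible)
    (hGZK : rank_eq_analyticRank_of_analyticRank_le_one) :
    MultiplicativeRankZeroTwoConverse ↔
      ∀ (W : WeierstrassCurve ℚ) [W.IsElliptic] [W.IsGloballyMinimal], ¬ W.HasCM → Mult W 2 →
        W.mordellWeilRank = 0 → W.shaCorank 2 = 0 → ∀ (q : ℕ) [Fact q.Prime], 5 ≤ q →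
          W.HasGoodReductionAtPrime q → ¬ (q : ℤ) ∣ W.frobeniusTrace q → W.shaCorank q = 0 := by
  constructor
  · intro hC W _ _ hncm hred hr h0 q _ _ _ _
    exact slice_of_multiplicativeRankZeroTwoConverse hC hGZK W hncm hred hr h0 q
  · intro hsl W _ _ hncm hred hs
    obtain ⟨q, hq, hq5, hgood, hord, hirr⟩ := exists_goodOrdinary_irreducible hM W
    have e2 := W.selmerCorank_eq_mordellWeilRank_add_holds 2
    have eq := W.selmerCorank_eq_mordellWeilRank_add_holds q
    have ht : W.shaCorank q = 0 := hsl W hncm hred (by omega) (by omega) q hq5 hgood hord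
    exact analyticRank_eq_zero_of_selmerCorank_eq_zero_of_mazurMainConjecture hmod hMC W q hq5 hgood hord hirr
      (by omega)

end Summit.BirchSwinnertonDyer.BirchSwinnertonDyer.Theorems.ShaPrimaryTransferTwoConverseItems
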